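import Mathlib
import HarnessLib
import Literature.NumberTheory.LFunctions.RiemannXiFourier

/-!
# The odd class seed transports to `Ψ′`: `x^{1/2} Σ_{n≥1} h_o(nx)/κ_o = −4(2π)^{1/4} Ψ′(u)`, `x = √(2π) e^{u/2}`

Helper file (`--supports stmt-RiemannHypothesis-0098`), elementary algebra on the tree's `LagariasMontague.Psi`, no
definitions.  Seat rh-explicit-weil-5 gen15 (file of record `HOME/rh-explicit-weil-5/WEIL5-KAPPA.md` §1; odd twin of
`Theorems/WeilHermiteSeedRiemannKernel.lean`).

Context (documentation only).  The ODD class seed of the compressed Weil form tends to `h_o = h₆ − √(5/8)h₂ =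
κ_o·y²(y⁴ − (15/2)y² + 15/2)e^{−y²/2}` (`κ_o = 2/(3√5 π^{1/4})`), whose Mellin transform carries the extra factor `(s − 1/2)`
(`WeilHermiteSeedMellin.hermiteSeedOdd_mellin`).  On the critical line `(s − 1/2)ξ(s) = it·𝓕Ψ(t/4π) = 2·𝓕(Ψ′)(t/4π)`, and
indeed, TERM BY TERM in the coordinate `x = √(2π)e^{u/2}` (`y_n = (n+1)x`, `a_n = π(n+1)²`, `Y = a_neᵘ`, `y_n² = 2Y`):
`y²(y⁴ − (15/2)y² + 15/2) = 8Y³ − 30Y² + 15Y = −4·(δp)(Y)` with `p = 2X² − 3X`, `δp = Xp′ + (1/4 − X)p` the tree's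
`thetaδ psiPoly` (`Ψ′ = S_{δp}`, `deriv_Psi`).  Hence `x^{1/2}Σ_n y_n²(y_n⁴ − (15/2)y_n² + 15/2)e^{−y_n²/2} = −4(2π)^{1/4}Ψ′(u)`:
the transported odd seed is `−4κ_o(2π)^{1/4}Ψ′`, and its Gram norm is `8κ_o²√(2π)∫(Ψ′)² = (κ_o²/√(2π))∫_ℝ t²|ξ(1/2+it)|²dt`
(the odd constant `0.410296` of WEIL5-KAPPA §1; the Plancherel step `∫t²|ξ|² = 16π∫(Ψ′)²` is not in this file).

* `eval_thetaδ_psiPoly`                   : `(δp)(Y) = −2Y³ + (15/2)Y² − (15/4)Y`, so `2Y(4Y² − 15Y + 15/2) = −4·(δp)(Y)`;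
* `hermiteSeedOdd_term_eq`                : the termwise dictionary;
* `hermiteSeedOdd_transport_eq_deriv_Psi` : `(2π)^{1/4}e^{u/4}·Σ' n, y_n²(y_n⁴ − (15/2)y_n² + 15/2)e^{−y_n²/2} = −4(2π)^{1/4}·Ψ′(u)`.

Standard axioms only; no `sorry`.
-/

set_option linter.dupNamespace false
set_option autoImplicit false

noncomputable section

open Real Polynomial

namespace Summit.RiemannHypothesis.RiemannHypothesis.Theorems.WeilHermiteSeedOddRiemannKernel

open Literature.NumberTheory.LFunctions.LagariasMontague

/-- `(δ(2X² − 3X))(Y) = −2Y³ + (15/2)Y² − (15/4)Y` — so the odd seed polynomial `2Y(4Y² − 15Y + 15/2)` (in `Y = y²/2`)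
is `−4·(δp)(Y)`. -/
theorem eval_thetaδ_psiPoly (Y : ℝ) :
    (thetaδ psiPoly).eval Y = -2 * Y ^ 3 + 15 / 2 * Y ^ 2 - 15 / 4 * Y := by
  simp [thetaδ, psiPoly]
  ring

/-- **Termwise dictionary (odd class).**  With `x = √(2π)e^{u/2}`, `y = (n+1)x`:
`(2π)^{1/4}e^{u/4}·y²(y⁴ − (15/2)y² + 15/2)e^{−y²/2} = −4(2π)^{1/4}·thetaTerm (δ psiPoly) n u`. -/
theorem hermiteSeedOdd_term_eq (n : ℕ) (u : ℝ) :
    (2 * π) ^ ((1 : ℝ) / 4) * Real.exp (u / 4) *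
        ((((n : ℝ) + 1) * (Real.sqrt (2 * π) * Real.exp (u / 2))) ^ 2 *
          (((((n : ℝ) + 1) * (Real.sqrt (2 * π) * Real.exp (u / 2))) ^ 2) ^ 2
            - 15 / 2 * (((n : ℝ) + 1) * (Real.sqrt (2 * π) * Real.exp (u / 2))) ^ 2 + 15 / 2) *
          Real.exp (-(((n : ℝ) + 1) * (Real.sqrt (2 * π) * Real.exp (u / 2))) ^ 2 / 2)) =
      -4 * (2 * π) ^ ((1 : ℝ) / 4) * thetaTerm (thetaδ psiPoly) n u := by
  -- the coordinate identity `((n+1)x)² = 2 a_n eᵘ` (as in `WeilHermiteSeedRiemannKernel.transportCoord_sq_mul`)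
  have hx : (((n : ℝ) + 1) * (Real.sqrt (2 * π) * Real.exp (u / 2))) ^ 2 = 2 * thetaWeight n * Real.exp u := by
    have hsq : Real.sqrt (2 * π) ^ 2 = 2 * π := Real.sq_sqrt (by positivity)
    have hexp : Real.exp (u / 2) ^ 2 = Real.exp u := by
      rw [sq, ← Real.exp_add]; congr 1; ring
    unfold thetaWeight
    calc (((n : ℝ) + 1) * (Real.sqrt (2 * π) * Real.exp (u / 2))) ^ 2
        = ((n : ℝ) + 1) ^ 2 * Real.sqrt (2 * π) ^ 2 * Real.exp (u / 2) ^ 2 := by ring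
      _ = 2 * (π * ((n : ℝ) + 1) ^ 2) * Real.exp u := by rw [hsq, hexp]; ring
  rw [hx, thetaTerm, Real.exp_sub]
  have h : Real.exp (-(2 * thetaWeight n * Real.exp u) / 2) = Real.exp (-(thetaWeight n * Real.exp u)) := by
    congr 1; ring
  rw [h, Real.exp_neg, eval_thetaδ_psiPoly]
  have hpos : Real.exp (thetaWeight n * Real.exp u) ≠ 0 := (Real.exp_pos _).ne'
  field_simp
  ring

/-- **The transported odd seed is `−4κ_o(2π)^{1/4}Ψ′`**: with `x = √(2π)e^{u/2}`, `y_n = (n+1)x`,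
`x^{1/2}·Σ_{n≥0} y_n²(y_n⁴ − (15/2)y_n² + 15/2)e^{−y_n²/2} = −4(2π)^{1/4}·Ψ′(u)` (`Ψ′ = deriv Psi = S_{δ(2X²−3X)}`). -/
theorem hermiteSeedOdd_transport_eq_deriv_Psi (u : ℝ) :
    (2 * π) ^ ((1 : ℝ) / 4) * Real.exp (u / 4) *
        (∑' n : ℕ, (((n : ℝ) + 1) * (Real.sqrt (2 * π) * Real.exp (u / 2))) ^ 2 *
          (((((n : ℝ) + 1) * (Real.sqrt (2 * π) * Real.exp (u / 2))) ^ 2) ^ 2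
            - 15 / 2 * (((n : ℝ) + 1) * (Real.sqrt (2 * π) * Real.exp (u / 2))) ^ 2 + 15 / 2) *
          Real.exp (-(((n : ℝ) + 1) * (Real.sqrt (2 * π) * Real.exp (u / 2))) ^ 2 / 2)) =
      -4 * (2 * π) ^ ((1 : ℝ) / 4) * deriv Psi u := by
  rw [← tsum_mul_left, deriv_Psi, thetaSeries]
  rw [show (-4 * (2 * π) ^ ((1 : ℝ) / 4) * ∑' n : ℕ, thetaTerm (thetaδ psiPoly) n u) =
      ∑' n : ℕ, -4 * (2 * π) ^ ((1 : ℝ) / 4) * thetaTerm (thetaδ psiPoly) n u from (tsum_mul_left).symm]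
  exact tsum_congr (fun n => hermiteSeedOdd_term_eq n u)

end Summit.RiemannHypothesis.RiemannHypothesis.Theorems.WeilHermiteSeedOddRiemannKernel

end
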